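import Summits.Ventures.PercRepro.Night2BasisMass

/-!
# night-2: lossy bases have rank `5` and are not inside a hyperplane of `G` — the count inside a target with a
fat closure

A lossy five-point set `Q'` (`lossyBasis`) has a face `(K ∪ Q').erase w` of rank `5` off which `w` lies, so
`K ∪ Q'` has rank `6` and `Q'` rank `5` (`rkN_eq_five_of_lossyBasis`); hence `Q'` is not inside any hyperplane
`clF B` (`B` a thin member) of `G` (`not_subset_clF_of_lossyBasis`), and the lossy five-point subsets of `T ∖ K` number at
most `C(|T ∖ K|, 5) − C(|T ∖ K ∩ clF B|, 5)` (`card_lossy_le_choose_sub`) — with a fat closure `clF B ⊇ V ∖ {≤ 2 points}`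
this is `C(a, 4)·b + C(a, 3)·C(b, 2)`, `a = |T' ∩ clF B|`, `b = |T' ∖ clF B| ≤ 2`: the mass input of the profile template
(paper NIGHT-2-g31 §3.3 (1)).
-/

namespace PercRepro.Shadow

open PercRepro.ThmH PercRepro.PerFlat

variable {α : Type*} [DecidableEq α] {M : Matroid α} [M.Finite] {G : Finset α}

/-- A lossy five-point set has rank `5`. -/
theorem rkN_eq_five_of_lossyBasis (hG : G ∈ flatsQ M (5 + 1)) (hk : kColoops M G = 1) {Q' : Finset α}
    (hQ'G : Q' ⊆ G \ coloops M G) (h : lossyBasis M G Q') : rkN M Q' = 5 := by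
  obtain ⟨w, hw, ⟨hthin, hwcl⟩, -⟩ := h
  have hGg : G ⊆ gr M := (mem_flatsQ.1 hG).1
  have hKG : coloops M G ⊆ G := fun y hy => (mem_coloops.1 hy).1
  set Q := coloops M G ∪ Q' with hQ
  have hQG : Q ⊆ G := Finset.union_subset hKG (hQ'G.trans Finset.sdiff_subset)
  have hKQ : coloops M G ⊆ Q := Finset.subset_union_left
  have hwQ : w ∈ Q := Finset.mem_union_right _ hw
  have hr6 : rkN M Q = 6 := by
    have h1 : Q = insert w (Q.erase w) := (Finset.insert_erase hwQ).symm
    rw [h1, rkN_insert_of_notMem_clF (hGg (hQG hwQ)) (Finset.mem_sdiff.1 hwcl).2, rkN_eq_five_of_mem_thinMembers hthin]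
  have hQK : Q \ coloops M G = Q' := by
    rw [hQ, Finset.union_sdiff_cancel_left]
    rw [Finset.disjoint_left]
    intro a ha ha'
    exact (Finset.mem_sdiff.1 (hQ'G ha')).2 ha
  have := rkN_eq_rkN_sdiff_add_one hG hk (S := Q) hQG (Finset.Subset.refl _) hKQ
  rw [hQK] at this
  omega

/-- A lossy five-point set is not inside the closure of a thin member (a hyperplane of `G`). -/
theorem not_subset_clF_of_lossyBasis (hG : G ∈ flatsQ M (5 + 1)) (hd : (gr M \ G).card = 2)
    {Q' : Finset α} (hQ'G : Q' ⊆ G \ coloops M G) (h : lossyBasis M G Q')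
    {B : Finset α} (hB : B ∈ thinMembers M 5 G) : ¬ Q' ⊆ clF M B := by
  intro hsub
  have hd' : (gr M \ G).card ≤ 5 := by omega
  have hGg : G ⊆ gr M := (mem_flatsQ.1 hG).1
  have hKB : coloops M G ⊆ B := coloops_subset_of_mem_thinMembers hG hd' hB
  have hBG : B ⊆ G := subset_G_of_mem_thinMembers hB
  have hQsub : coloops M G ∪ Q' ⊆ clF M B :=
    Finset.union_subset (hKB.trans (subset_clF_of_subset_gr (hBG.trans hGg))) hsub
  have h5 : rkN M (coloops M G ∪ Q') ≤ 5 := by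
    have := rkN_mono (M := M) hQsub
    rw [rkN_clF, rkN_eq_five_of_mem_thinMembers hB] at this
    exact this
  obtain ⟨w, hw, ⟨hthin, hwcl⟩, -⟩ := h
  have hwQ : w ∈ coloops M G ∪ Q' := Finset.mem_union_right _ hw
  have hr6 : rkN M (coloops M G ∪ Q') = 6 := by
    have h1 : coloops M G ∪ Q' = insert w ((coloops M G ∪ Q').erase w) := (Finset.insert_erase hwQ).symm
    rw [h1, rkN_insert_of_notMem_clF (hGg ((Finset.mem_sdiff.1 (hQ'G hw)).1)) (Finset.mem_sdiff.1 hwcl).2,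
      rkN_eq_five_of_mem_thinMembers hthin]
  omega

/-- **The lossy five-point subsets of `T ∖ K` number at most `C(|T ∖ K|, 5) − C(|T ∖ K ∩ clF B|, 5)`** for every thin
member `B`. -/
theorem card_lossy_le_choose_sub (hG : G ∈ flatsQ M (5 + 1)) (hd : (gr M \ G).card = 2)
    {T : Finset α} (hTG : T ⊆ G) {B : Finset α} (hB : B ∈ thinMembers M 5 G) :
    (((T \ coloops M G).powersetCard 5).filter (fun Q' => lossyBasis M G Q')).card ≤
      (T \ coloops M G).card.choose 5 - ((T \ coloops M G) ∩ clF M B).card.choose 5 := by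
  set T' := T \ coloops M G with hT'
  have hT'G : T' ⊆ G \ coloops M G := Finset.sdiff_subset_sdiff hTG (Finset.Subset.refl _)
  -- the lossy sets are among the five-point subsets not inside `clF B`
  have hsub : (T'.powersetCard 5).filter (fun Q' => lossyBasis M G Q') ⊆
      (T'.powersetCard 5).filter (fun Q' => ¬ Q' ⊆ clF M B) := by
    intro Q' hQ'
    rw [Finset.mem_filter] at hQ' ⊢
    exact ⟨hQ'.1, not_subset_clF_of_lossyBasis hG hd ((Finset.mem_powersetCard.1 hQ'.1).1.trans hT'G) hQ'.2 hB⟩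
  refine (Finset.card_le_card hsub).trans ?_
  -- the five-point subsets inside `clF B` are those of `T' ∩ clF B`
  have hin : (T'.powersetCard 5).filter (fun Q' => Q' ⊆ clF M B) = (T' ∩ clF M B).powersetCard 5 := by
    ext Q'
    rw [Finset.mem_filter, Finset.mem_powersetCard, Finset.mem_powersetCard, Finset.subset_inter_iff]
    tauto
  have hsplit := Finset.card_filter_add_card_filter_not (s := T'.powersetCard 5) (fun Q' => Q' ⊆ clF M B)
  rw [hin, Finset.card_powersetCard, Finset.card_powersetCard] at hsplit
  omega

end PercRepro.Shadow
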